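import Summits.BirchSwinnertonDyer.BirchSwinnertonDyer.Theorems.ResidualThetaTransportAtTwoPlusDualLayerSocle
import Summits.BirchSwinnertonDyer.BirchSwinnertonDyer.Theorems.ResidualThetaTransportAtTwoPlusHonestLayerCount
import Literature.NumberTheory.EllipticCurves.Sprung2012.ColemanMapLambdaActionProofs
import HarnessLib

/-!
# The layers `S[p^J, ω_n]` of a cofree rank-one dual pair are CYCLIC `ℤ[φ]`-modules: a generator `g_n` with
# `S[p^J, ω_n] = {P(φ)·g_n : P ∈ ℤ[Y]}` (θ-extraction for the ISO θ-plan)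

Routes `ResidualThetaTransportAtTwo` (RTT, crux r201 `ResidualLambdaFormulaNegDiscAtTwo`, stmt-BirchSwinnertonDyer-23110) /
`ThetaPartnerAtTwo`. Seat `prover-bsd-wall-tp2-p2x-w3` g13; `--supports stmt-BirchSwinnertonDyer-23110 --as helper`. THEOREMS ONLY (no
definition, no named fact, no instance, no `sorry`); PURE ALGEBRA; closes nothing.

For a dual pair `IsDualPair p (φ − 1) toDual` with `X ≃ₗ[Λ] Λ` (the output of (R1)@2) and `J ≥ 1`:
* §1 `pow_dvd_of_sum_zsmul_pow_mem_omegaIdeal` — REDUCED UNIQUENESS in `Λ/(ω_n, p^J)`: `∑_{i<pⁿ} dᵢ(1+T)ⁱ ∈ (ω_n) + (p^J)` with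
  `dᵢ ∈ ℤ` forces `p^J ∣ dᵢ` (Weierstrass division by the distinguished `ω_n`: tree `Kato2004.IwasawaH1Exists.exists_polynomial_sub_coe_
  mem_span`, `Sprung2012.omega_dvd_of_coe_dvd`, then the shift `T ↦ T − 1`);
* §2 `exists_pow_nsmul_norm_ne_zero` — some `g ∈ S[p^J, ω_n]` has `p^{J−1}·N_{n/0} g ≠ 0` (`N_{n/0} = ∑_{i<pⁿ} φⁱ` maps the layer ONTO
  `S[p^J, φ = 1]`, whose `p^{J−1}`-multiples fill `S[p, φ = 1] ≠ 0` — cofree calculus of `…PlusDualLayerAlgebra/Norms/Omega`);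
  `aeval_mem_omegaIdeal_of_apply_eq_zero` — for such `g`, `P(φ) g = 0` forces `P(1+T) ∈ (ω_n) + (p^J)` (socle lemma
  `socle_geom_sum_mem_span_sup_omegaIdeal`: otherwise `p^{J−1}ν_{n/0} ∈ (P(1+T)) + I(n,J)` would kill `g`);
* §3 **`exists_generator_torsionBy_omega`** — `S[p^J, ω_n] = {∑_{i<pⁿ} cᵢ φⁱ g : 0 ≤ cᵢ < p^J}`: the `p^{J pⁿ}` combinations are pairwise
  distinct (§1–§2) and `#S[p^J, ω_n] = p^{J pⁿ}` (`natCard_torsionBy_pow_fixed_eq_pow`).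

HONEST FRAMING: closes nothing; ISO / 23110 NOT proved; BSD is not proved by any of this.
References: [BDKim2007] Prop. 3.15 (proof: «`H_n[p^j] ≅ Hom(Λ_n, ℤ/p^j)`»), Prop. 3.17; [Washington1997] §7.1 (Prop. 7.2), §13.2.
-/

set_option autoImplicit false
-- D-0017: single-problem summit, so `Summit.BirchSwinnertonDyer.BirchSwinnertonDyer.…` repeats a namespace BY DESIGN.
set_option linter.dupNamespace false

noncomputable section

open scoped Classical
open Polynomial Finset Literature.NumberTheory.EllipticCurves Literature.NumberTheory.EllipticCurves.IwasawaDual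

namespace Summit.BirchSwinnertonDyer.BirchSwinnertonDyer.Theorems.ResidualThetaLayer.PlusDual

/-! ## §1 Reduced uniqueness modulo `(ω_n, p^J)` -/

section Reduced

variable (p : ℕ) [hp : Fact p.Prime]

/-- **Reduced uniqueness in `Λ/(ω_n, p^J)`**: if `∑_{i<pⁿ} dᵢ (1+T)ⁱ ∈ (ω_n) + (p^J)` with integers `dᵢ`, then `p^J ∣ dᵢ` for all `i`
(the classes of `(1+T)ⁱ`, `i < pⁿ`, form a `ℤ/p^J`-basis of `Λ/(ω_n, p^J) = (ℤ/p^J)[Γ/Γ_n]`). [cite: Washington1997, §7.1 (Prop. 7.2)] -/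
theorem pow_dvd_of_sum_zsmul_pow_mem_omegaIdeal (n J : ℕ) (d : ℕ → ℤ)
    (h : (∑ i ∈ range (p ^ n), (d i : PowerSeries ℤ_[p]) * (1 + PowerSeries.X) ^ i) ∈
      Ideal.span {(((X + 1 : ℤ_[p][X]) ^ p ^ n - 1 : ℤ_[p][X]) : PowerSeries ℤ_[p])} ⊔
        Ideal.span {PowerSeries.C ((p : ℤ_[p]) ^ J)}) :
    ∀ i < p ^ n, (p : ℤ) ^ J ∣ d i := by
  have hωmon : ((X + 1 : ℤ_[p][X]) ^ p ^ n - 1).Monic := (Kato2004.IwasawaH1Exists.isDistinguishedAt_omega p n).monic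
  have hωdeg : ((X + 1 : ℤ_[p][X]) ^ p ^ n - 1).natDegree = p ^ n := UniversalToricDescentTorsionFreeByCount.natDegree_omega p n
  have hpn : 1 ≤ p ^ n := Nat.one_le_pow _ _ hp.out.pos
  have hω1 : ((X + 1 : ℤ_[p][X]) ^ p ^ n - 1) ≠ 1 := by
    intro h1
    have := congrArg Polynomial.natDegree h1
    rw [hωdeg, natDegree_one] at this
    omega
  obtain ⟨A, B, hAB⟩ := mem_span_sup_span_iff.mp h
  -- reduce `B` modulo `ω_n` to a polynomial of degree `< pⁿ`
  obtain ⟨Br, hBr⟩ := Kato2004.IwasawaH1Exists.exists_polynomial_sub_coe_mem_span p n B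
  obtain ⟨B', hB'⟩ := Ideal.mem_span_singleton'.mp hBr
  set Bm : ℤ_[p][X] := Br %ₘ ((X + 1 : ℤ_[p][X]) ^ p ^ n - 1) with hBm
  set Bd : ℤ_[p][X] := Br /ₘ ((X + 1 : ℤ_[p][X]) ^ p ^ n - 1) with hBd
  have hdiv : Bm + ((X + 1 : ℤ_[p][X]) ^ p ^ n - 1) * Bd = Br := Polynomial.modByMonic_add_div Br _
  set R : ℤ_[p][X] := (∑ i ∈ range (p ^ n), C (d i : ℤ_[p]) * (X + 1) ^ i) - C ((p : ℤ_[p]) ^ J) * Bm with hR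
  have hsum : ((∑ i ∈ range (p ^ n), C (d i : ℤ_[p]) * (X + 1) ^ i : ℤ_[p][X]) : PowerSeries ℤ_[p]) =
      ∑ i ∈ range (p ^ n), (d i : PowerSeries ℤ_[p]) * (1 + PowerSeries.X) ^ i := by
    rw [← Polynomial.coeToPowerSeries.ringHom_apply, map_sum]
    refine Finset.sum_congr rfl fun i _ ↦ ?_
    rw [Polynomial.coeToPowerSeries.ringHom_apply, Polynomial.coe_mul, Polynomial.coe_pow, Polynomial.coe_add, Polynomial.coe_C,
      Polynomial.coe_X, Polynomial.coe_one, map_intCast, add_comm]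
  -- `↑R ∈ (ω_n)Λ`
  have hRcoe : (R : PowerSeries ℤ_[p]) = (((X + 1 : ℤ_[p][X]) ^ p ^ n - 1 : ℤ_[p][X]) : PowerSeries ℤ_[p]) *
      (A + PowerSeries.C ((p : ℤ_[p]) ^ J) * (B' + (Bd : PowerSeries ℤ_[p]))) := by
    have hBrcoe : (Br : PowerSeries ℤ_[p]) = (Bm : PowerSeries ℤ_[p]) +
        (((X + 1 : ℤ_[p][X]) ^ p ^ n - 1 : ℤ_[p][X]) : PowerSeries ℤ_[p]) * (Bd : PowerSeries ℤ_[p]) := by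
      rw [← Polynomial.coe_mul, ← Polynomial.coe_add, hdiv]
    rw [hR, Polynomial.coe_sub, Polynomial.coe_mul, Polynomial.coe_C, hsum, hAB]
    linear_combination -(PowerSeries.C ((p : ℤ_[p]) ^ J) * hB') + PowerSeries.C ((p : ℤ_[p]) ^ J) * hBrcoe
  have hdvd : ((X + 1 : ℤ_[p][X]) ^ p ^ n - 1) ∣ R := Sprung2012.omega_dvd_of_coe_dvd ⟨_, hRcoe⟩
  -- `deg R < pⁿ`, hence `R = 0`
  have hRdeg : R.natDegree < ((X + 1 : ℤ_[p][X]) ^ p ^ n - 1).natDegree := by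
    rw [hωdeg, hR]
    refine lt_of_le_of_lt (natDegree_sub_le _ _) (max_lt ?_ ?_)
    · refine lt_of_le_of_lt (natDegree_sum_le_of_forall_le _ _ (n := p ^ n - 1) fun i hi ↦ ?_) (by omega)
      refine (natDegree_C_mul_le _ _).trans ?_
      rw [← C_1, (monic_X_add_C (1 : ℤ_[p])).natDegree_pow, natDegree_X_add_C, mul_one]
      have := Finset.mem_range.mp hi; omega
    · exact lt_of_le_of_lt (natDegree_C_mul_le _ _) (by rw [← hωdeg]; exact natDegree_modByMonic_lt Br hωmon hω1)
  have hR0 : R = 0 := Polynomial.eq_zero_of_dvd_of_natDegree_lt hdvd hRdeg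
  -- shift `T ↦ T − 1` and read off coefficients
  have hpoly : (∑ i ∈ range (p ^ n), C (d i : ℤ_[p]) * (X + 1 : ℤ_[p][X]) ^ i) = C ((p : ℤ_[p]) ^ J) * Bm := sub_eq_zero.mp hR0
  have hshift := congrArg (fun P : ℤ_[p][X] ↦ P.comp (X - 1)) hpoly
  simp only [Polynomial.sum_comp, mul_comp, C_comp, pow_comp, add_comp, X_comp, one_comp, sub_add_cancel] at hshift
  intro i hi
  have hcoeff := congrArg (fun P : ℤ_[p][X] ↦ P.coeff i) hshift
  simp only [finsetSum_coeff, coeff_C_mul, coeff_X_pow] at hcoeff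
  rw [Finset.sum_eq_single i (fun j _ hji ↦ by rw [if_neg (Ne.symm hji), mul_zero]) (fun hi' ↦ absurd (Finset.mem_range.mpr hi) hi'),
    if_pos rfl, mul_one] at hcoeff
  have hdvdp : (p : ℤ_[p]) ^ J ∣ (d i : ℤ_[p]) := ⟨_, hcoeff⟩
  have := (PadicInt.pow_p_dvd_int_iff J (d i)).mp hdvdp
  exact_mod_cast this

end Reduced

/-! ## §2 A layer element not killed by the socle, and its annihilator -/

section Generator

variable {p : ℕ} [hp : Fact p.Prime]
variable {S : Type*} [AddCommGroup S] {φ : AddMonoid.End S}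
variable {Xd : Type*} [AddCommGroup Xd] [Module (PowerSeries ℤ_[p]) Xd] {toDual : Xd →+ (S →+ AddCircle (1 : ℚ))}

/-- Transpose of `p^k·ν_{n/0} = p^k ∑_{i<pⁿ}(1+T)ⁱ`: it acts through `toDual` as `p^k·∑_{i<pⁿ} φⁱ`. [folklore] -/
theorem toDual_C_pow_mul_geom_sum_smul (h : IsDualPair p (φ - 1) toDual) (k n : ℕ) (x : Xd) (s : S) :
    toDual ((PowerSeries.C ((p : ℤ_[p]) ^ k) * ∑ i ∈ range (p ^ n), (1 + PowerSeries.X : PowerSeries ℤ_[p]) ^ i) • x) s =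
      toDual x (p ^ k • (∑ i ∈ range (p ^ n), φ ^ i : AddMonoid.End S) s) := by
  have hC : PowerSeries.C ((p : ℤ_[p]) ^ k) = ((p ^ k : ℕ) : PowerSeries ℤ_[p]) := by rw [Nat.cast_pow, map_pow, map_natCast]
  rw [mul_smul, hC, Nat.cast_smul_eq_nsmul, nsmul_eval, ← map_nsmul, Finset.sum_smul, map_sum toDual, AddMonoidHom.finsetSum_apply,
    end_finset_sum_apply, map_sum (toDual x)]
  exact Finset.sum_congr rfl fun i _ ↦ h.toDual_one_add_X_pow_smul i x _

/-- **A layer element not killed by the socle**: for `J ≥ 1` some `g ∈ S[p^J, ω_n]` has `p^{J−1}·N_{n/0} g ≠ 0`, `N_{n/0} = ∑_{i<pⁿ} φⁱ`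
(`N_{n/0}` maps the layer ONTO `S[p^J, φ = 1]`, whose `p^{J−1}`-multiples exhaust `S[p, φ = 1]`, a group of order `p`).
[cite: BDKim2007, Prop. 3.15 (proof)] [cite: Washington1997, §13.2] -/
theorem exists_pow_nsmul_norm_ne_zero (h : IsDualPair p (φ - 1) toDual) (e : Xd ≃ₗ[PowerSeries ℤ_[p]] PowerSeries ℤ_[p])
    {J : ℕ} (hJ : 1 ≤ J) (n : ℕ) :
    ∃ g : S, (p ^ J • g = 0 ∧ (φ ^ p ^ n) g = g) ∧ p ^ (J - 1) • (∑ i ∈ range (p ^ n), φ ^ i : AddMonoid.End S) g ≠ 0 := by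
  -- a non-zero element of `S[p, φ = 1]`
  have hcard : Nat.card {s : S // p ^ 1 • s = 0 ∧ (φ ^ p ^ 0) s = s} = p ^ (1 * p ^ 0) := natCard_torsionBy_pow_fixed_eq_pow h e 1 0
  have hp1 : p ^ (1 * p ^ 0) = p := by rw [pow_zero, mul_one, pow_one]
  rw [hp1] at hcard
  have hnt : ¬ Subsingleton {s : S // p ^ 1 • s = 0 ∧ (φ ^ p ^ 0) s = s} := by
    intro hsub
    haveI : Finite {s : S // p ^ 1 • s = 0 ∧ (φ ^ p ^ 0) s = s} := Nat.finite_of_card_ne_zero (by rw [hcard]; exact hp.out.ne_zero)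
    have := Finite.card_le_one_iff_subsingleton.mpr hsub
    rw [hcard] at this
    exact absurd this (not_le.mpr hp.out.one_lt)
  obtain ⟨⟨s₁, hs₁⟩, ⟨s₂, hs₂⟩, hne⟩ := not_subsingleton_iff_nontrivial.mp hnt |>.exists_pair_ne
  -- one of them is non-zero; WLOG produce a non-zero element `t` of `S[p, φ = 1]`
  have hex : ∃ t : S, (p ^ 1 • t = 0 ∧ (φ ^ p ^ 0) t = t) ∧ t ≠ 0 := by
    by_cases h1 : s₁ = 0
    · refine ⟨s₂, hs₂, fun h2 ↦ hne (Subtype.ext (show s₁ = s₂ by rw [h1, h2]))⟩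
    · exact ⟨s₁, hs₁, h1⟩
  obtain ⟨t, ⟨htp, htφ⟩, ht0⟩ := hex
  rw [pow_one] at htp
  rw [pow_zero, pow_one] at htφ
  -- lift `t` to `S[p^J, φ = 1]` along multiplication by `p^{J−1}`
  have hX : (Polynomial.X : ℤ_[p][X]).IsDistinguishedAt (IsLocalRing.maximalIdeal ℤ_[p]) := by
    simpa using IwasawaAlgebra.isDistinguishedAt_X_sub_C p (Submodule.zero_mem (IsLocalRing.maximalIdeal ℤ_[p]))
  have hqX : Ideal.span {(PowerSeries.X : PowerSeries ℤ_[p])} = Ideal.span {((Polynomial.X : ℤ_[p][X]) : PowerSeries ℤ_[p])} := by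
    rw [Polynomial.coe_X]
  obtain ⟨t', ⟨ht'p, ht'φ⟩, ht'eq⟩ := exists_pow_nsmul_eq_of_mem_torsionBy_ker h e hX hqX (Ψ := ((φ - 1 : AddMonoid.End S) : S →+ S))
    (fun x s ↦ h.T_smul x s) (J - 1) 1 (s := t) ⟨by rw [pow_one]; exact htp, by show φ t - t = 0; rw [htφ, sub_self]⟩
  rw [show 1 + (J - 1) = J by omega] at ht'p
  -- `t' = N_{n/0} g` for some `g` in the layer
  have hmem : t' ∈ (⇑(∑ i ∈ Finset.range (p ^ (n - 0)), (φ ^ p ^ 0) ^ i : AddMonoid.End S)) ''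
      {s : S | p ^ J • s = 0 ∧ (φ ^ p ^ n) s = s} := by
    rw [norm_image_torsionBy_eq h e (Nat.zero_le n) J]
    refine ⟨ht'p, ?_⟩
    have : φ t' - t' = 0 := ht'φ
    rw [pow_zero, pow_one]; exact (sub_eq_zero.mp this)
  obtain ⟨g, hg, hgt⟩ := hmem
  refine ⟨g, hg, ?_⟩
  have hN : (∑ i ∈ Finset.range (p ^ (n - 0)), (φ ^ p ^ 0) ^ i : AddMonoid.End S) = ∑ i ∈ range (p ^ n), φ ^ i := by
    rw [Nat.sub_zero, pow_zero, pow_one]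
  rw [← hN, hgt, ht'eq]
  exact ht0

/-- **The annihilator of a socle-detecting element lies in `I(n,J)`**: if `g ∈ S[p^J, ω_n]` has `p^{J−1}N_{n/0} g ≠ 0` and `P(φ) g = 0`
for an integer polynomial `P`, then `P(1+T) ∈ (ω_n) + (p^J)` (otherwise the socle lemma produces `r` with
`r·P(1+T) ≡ p^{J−1}ν_{n/0}`, whose transpose kills `g`). [cite: BDKim2007, Prop. 3.15 (proof)] [cite: Washington1997, §13.2] -/
theorem aeval_mem_omegaIdeal_of_apply_eq_zero (h : IsDualPair p (φ - 1) toDual) {J : ℕ} (hJ : 1 ≤ J) (n : ℕ) {g : S}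
    (hg : p ^ J • g = 0 ∧ (φ ^ p ^ n) g = g) (hgN : p ^ (J - 1) • (∑ i ∈ range (p ^ n), φ ^ i : AddMonoid.End S) g ≠ 0)
    {P : ℤ[X]} (hP : Polynomial.aeval φ P g = 0) :
    Polynomial.aeval (1 + PowerSeries.X : PowerSeries ℤ_[p]) P ∈
      Ideal.span {(((X + 1 : ℤ_[p][X]) ^ p ^ n - 1 : ℤ_[p][X]) : PowerSeries ℤ_[p])} ⊔
        Ideal.span {PowerSeries.C ((p : ℤ_[p]) ^ J)} := by
  by_contra hnot
  have hsoc := socle_geom_sum_mem_span_sup_omegaIdeal p hJ n hnot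
  obtain ⟨y, hy, z, hz, hyz⟩ := Submodule.mem_sup.mp hsoc
  obtain ⟨r, rfl⟩ := Ideal.mem_span_singleton'.mp hy
  obtain ⟨u, v, hz'⟩ := mem_span_sup_span_iff.mp hz
  apply hgN
  have hall : ∀ x : Xd, toDual x (p ^ (J - 1) • (∑ i ∈ range (p ^ n), φ ^ i : AddMonoid.End S) g) = 0 := by
    intro x
    rw [← toDual_C_pow_mul_geom_sum_smul h (J - 1) n x g, ← hyz, hz', add_smul, add_smul, map_add, map_add,
      AddMonoidHom.add_apply, AddMonoidHom.add_apply]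
    -- `(r·P(1+T))•x`, `(ω_n u)•x`, `(p^J v)•x` all pair to zero against `g`
    have h1 : toDual ((r * Polynomial.aeval (1 + PowerSeries.X : PowerSeries ℤ_[p]) P) • x) g = 0 := by
      rw [mul_comm, mul_smul, toDual_aeval_one_add_X_smul h P, hP, map_zero]
    have h2 : toDual (((((X + 1 : ℤ_[p][X]) ^ p ^ n - 1 : ℤ_[p][X]) : PowerSeries ℤ_[p]) * u) • x) g = 0 := by
      rw [mul_smul, transpose_omega h n]
      show toDual (u • x) ((φ ^ p ^ n) g - g) = 0
      rw [hg.2, sub_self, map_zero]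
    have h3 : toDual ((PowerSeries.C ((p : ℤ_[p]) ^ J) * v) • x) g = 0 := by
      rw [mul_smul, show PowerSeries.C ((p : ℤ_[p]) ^ J) = ((p ^ J : ℕ) : PowerSeries ℤ_[p]) by rw [Nat.cast_pow, map_pow, map_natCast],
        Nat.cast_smul_eq_nsmul, nsmul_eval, hg.1, map_zero]
    rw [h1, h2, h3, add_zero, add_zero]
  by_contra hne
  obtain ⟨c, hc⟩ := CharacterModule.exists_character_apply_ne_zero_of_ne_zero hne
  obtain ⟨x, rfl⟩ := h.bijective.2 c
  exact hc (hall x)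

/-! ## §3 Cyclicity of the layers -/

/-- **The layers of a cofree rank-one dual pair are CYCLIC `ℤ[φ]`-modules.** For `J ≥ 1` and every `n` there is `g ∈ S[p^J, ω_n]`
(`p^J g = 0`, `φ^{pⁿ} g = g`) such that every `s ∈ S[p^J, ω_n]` is `∑_{i<pⁿ} cᵢ φⁱ g` with `0 ≤ cᵢ < p^J` — uniquely, by counting:
`#S[p^J, ω_n] = p^{J pⁿ}` (`natCard_torsionBy_pow_fixed_eq_pow`) and the combinations are pairwise distinct (annihilator in `I(n,J)` +
reduced uniqueness). Kim: «`H_n[p^j] ≅ Hom(Λ_n, ℤ/p^j)`». [cite: BDKim2007, Prop. 3.15 (proof), Prop. 3.17] [cite: Washington1997, §13.2] -/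
theorem exists_generator_torsionBy_omega (h : IsDualPair p (φ - 1) toDual) (e : Xd ≃ₗ[PowerSeries ℤ_[p]] PowerSeries ℤ_[p])
    {J : ℕ} (hJ : 1 ≤ J) (n : ℕ) :
    ∃ g : S, (p ^ J • g = 0 ∧ (φ ^ p ^ n) g = g) ∧ p ^ (J - 1) • (∑ i ∈ range (p ^ n), φ ^ i : AddMonoid.End S) g ≠ 0 ∧
      ∀ s : S, (p ^ J • s = 0 ∧ (φ ^ p ^ n) s = s) →
        ∃ c : Fin (p ^ n) → ℕ, (∀ i, c i < p ^ J) ∧ s = ∑ i, c i • (φ ^ (i : ℕ)) g := by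
  obtain ⟨g, hg, hgN⟩ := exists_pow_nsmul_norm_ne_zero h e hJ n
  refine ⟨g, hg, hgN, fun s hs ↦ ?_⟩
  -- stability of the layer under `φ`
  have hφi : ∀ i : ℕ, p ^ J • (φ ^ i) g = 0 ∧ (φ ^ p ^ n) ((φ ^ i) g) = (φ ^ i) g := fun i ↦ by
    refine ⟨by rw [← map_nsmul, hg.1, map_zero], ?_⟩
    show (φ ^ p ^ n * φ ^ i) g = (φ ^ i) g
    rw [← pow_add, add_comm, pow_add]
    show (φ ^ i) ((φ ^ p ^ n) g) = (φ ^ i) g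
    rw [hg.2]
  -- the combination map
  let f : (Fin (p ^ n) → Fin (p ^ J)) → S := fun c ↦ ∑ i, ((c i : ℕ) : ℤ) • (φ ^ (i : ℕ)) g
  have hf_mem : ∀ c, p ^ J • f c = 0 ∧ (φ ^ p ^ n) (f c) = f c := fun c ↦ by
    refine ⟨?_, ?_⟩
    · rw [Finset.smul_sum]
      exact Finset.sum_eq_zero fun i _ ↦ by rw [smul_comm, (hφi i).1, smul_zero]
    · rw [map_sum]
      exact Finset.sum_congr rfl fun i _ ↦ by rw [map_zsmul, (hφi i).2]
  -- injectivity
  have hf : Function.Injective f := by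
    intro c c' hcc'
    -- the integer polynomial `Q = ∑ (cᵢ − c'ᵢ) Yⁱ` kills `g`
    let d : ℕ → ℤ := fun i ↦ if hi : i < p ^ n then ((c ⟨i, hi⟩ : ℕ) : ℤ) - ((c' ⟨i, hi⟩ : ℕ) : ℤ) else 0
    have hd : ∀ i : Fin (p ^ n), d i = ((c i : ℕ) : ℤ) - ((c' i : ℕ) : ℤ) := fun i ↦ by
      simp only [d, dif_pos i.2]
    have hQ : Polynomial.aeval φ (∑ i ∈ range (p ^ n), Polynomial.C (d i) * Polynomial.X ^ i : ℤ[X]) g = 0 := by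
      rw [map_sum, end_finset_sum_apply, Finset.sum_range (fun i ↦ (Polynomial.aeval φ (Polynomial.C (d i) * Polynomial.X ^ i)) g)]
      have : ∀ i : Fin (p ^ n), (Polynomial.aeval φ (Polynomial.C (d i) * Polynomial.X ^ (i : ℕ))) g =
          ((c i : ℕ) : ℤ) • (φ ^ (i : ℕ)) g - ((c' i : ℕ) : ℤ) • (φ ^ (i : ℕ)) g := fun i ↦ by
        rw [map_mul, map_pow, Polynomial.aeval_X, Polynomial.aeval_C, eq_intCast, hd, ← sub_smul]
        exact AddMonoid.End.intCast_apply _ _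
      simp only [this, Finset.sum_sub_distrib]
      exact sub_eq_zero.mpr hcc'
    have hmem := aeval_mem_omegaIdeal_of_apply_eq_zero h hJ n hg hgN hQ
    have hΛ : Polynomial.aeval (1 + PowerSeries.X : PowerSeries ℤ_[p]) (∑ i ∈ range (p ^ n), Polynomial.C (d i) * Polynomial.X ^ i : ℤ[X]) =
        ∑ i ∈ range (p ^ n), (d i : PowerSeries ℤ_[p]) * (1 + PowerSeries.X) ^ i := by
      rw [map_sum]
      exact Finset.sum_congr rfl fun i _ ↦ by rw [map_mul, map_pow, Polynomial.aeval_X, Polynomial.aeval_C, eq_intCast]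
    rw [hΛ] at hmem
    have hdvd := pow_dvd_of_sum_zsmul_pow_mem_omegaIdeal p n J d hmem
    have := funext_of_pow_dvd_sub (p := p) (R := p ^ n) (J := J) (c := fun i ↦ (c i : ℕ)) (c' := fun i ↦ (c' i : ℕ))
      (fun i ↦ (c i).2) (fun i ↦ (c' i).2) (fun i ↦ by rw [← hd]; exact hdvd i i.2)
    funext i
    exact Fin.ext (congrFun this i)
  -- counting
  have hfin : {t : S | p ^ J • t = 0 ∧ (φ ^ p ^ n) t = t}.Finite := finite_torsionBy_pow_fixed h e J n
  have hsub : Set.range f ⊆ {t : S | p ^ J • t = 0 ∧ (φ ^ p ^ n) t = t} := by rintro _ ⟨c, rfl⟩; exact hf_mem c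
  have hcard : {t : S | p ^ J • t = 0 ∧ (φ ^ p ^ n) t = t}.ncard ≤ (Set.range f).ncard := by
    rw [Set.ncard_range_of_injective hf]
    have h1 : Nat.card (Fin (p ^ n) → Fin (p ^ J)) = p ^ (J * p ^ n) := by
      rw [Nat.card_eq_fintype_card, Fintype.card_fun, Fintype.card_fin, Fintype.card_fin, ← pow_mul]
    have h2 : {t : S | p ^ J • t = 0 ∧ (φ ^ p ^ n) t = t}.ncard = p ^ (J * p ^ n) := by
      rw [← Nat.card_coe_set_eq]; exact natCard_torsionBy_pow_fixed_eq_pow h e J n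
    rw [h1, h2]
  have heq := Set.eq_of_subset_of_ncard_le hsub hcard hfin
  have hs' : s ∈ Set.range f := by rw [heq]; exact hs
  obtain ⟨c, hc⟩ := hs'
  refine ⟨fun i ↦ (c i : ℕ), fun i ↦ (c i).2, ?_⟩
  rw [← hc]
  exact Finset.sum_congr rfl fun i _ ↦ by rw [natCast_zsmul]

end Generator

end Summit.BirchSwinnertonDyer.BirchSwinnertonDyer.Theorems.ResidualThetaLayer.PlusDual

end
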